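import Summits.RiemannHypothesis.RiemannHypothesis.Theorems.Splittings.SplitXWucK1RC
import HarnessLib

/-!
# Splittings — x-wuc GEN-11 `SplitXWucK1R` (K1′(ℝ) AT THE STAKE) — mechanical carve part 4/14
Continuation of `Summits.RiemannHypothesis.RiemannHypothesis.Theorems.Splittings.SplitXWucK1RC`: byte-identical declaration units of the referee-passed extract `SplitXWucK1R.lean`
sha16 70c8eb2af2868881 (x-wuc g11; ref g10 PASS 2026-08-27T22:59:46Z; RULING #330); open namespaces/sections re-opened with their context.
HONEST LABEL: splitting search over kernel-typed RH-equivalences; K-CERT′ (complex `f`) stays OPEN; nothing here bears on the truth of RH.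
-/
set_option linter.dupNamespace false
noncomputable section
open scoped Classical ComplexConjugate
open Set Filter Topology Complex MeasureTheory
open Real Set Filter Topology
open Real Set MeasureTheory Complex Filter Topology
open scoped Real
namespace Summit.RiemannHypothesis.RiemannHypothesis.Theorems.Splittings.XWucG8
namespace DSLine
section ds
variable [hT : Fact ((0 : ℝ) < 2)]
omit hT in
/-- `summable_norm_dsCoeff` — helper of the x-wuc GEN-11 chain «K1′(ℝ) at the stake» (verbatim from the referee-passed extract `SplitXWucK1R.lean` 70c8eb2af2868881; role: see the module docstring). -/
theorem summable_norm_dsCoeff {ω : ℝ} (hω : Real.cos ω ≠ 0) :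
    Summable (fun n : ℤ => ‖(dsCoeff ω n : ℂ)‖) := by
  set s : ℝ := ω + π / 2 with hs_def
  -- eventually `‖c_n‖ ≤ (4 cos²ω / π²) / n²`
  have hg : Summable (fun n : ℤ => 4 * (Real.cos ω) ^ 2 / π ^ 2 * (1 / (n : ℝ) ^ 2)) :=
    (Real.summable_one_div_int_pow.mpr one_lt_two).mul_left _
  refine Summable.of_norm_bounded_eventually hg ?_
  rw [Filter.eventually_cofinite]
  obtain ⟨N, hN⟩ := exists_nat_ge (2 * |s| / π)
  refine (Set.finite_Icc (-(N : ℤ)) N).subset ?_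
  intro n hn
  simp only [mem_setOf_eq] at hn
  by_contra hout
  apply hn
  rw [Real.norm_eq_abs, abs_of_nonneg (norm_nonneg _), norm_dsCoeff hω, ← hs_def]
  -- |n| > N ⇒ π |n| ≥ 2|s| ⇒ |s - π n| ≥ π|n|/2
  have hnN : (N : ℝ) < |(n : ℝ)| := by
    rw [mem_Icc, not_and_or, not_le, not_le] at hout
    rw [← Int.cast_abs]
    rcases hout with h | h
    · have : (N : ℤ) < |n| := by rw [abs_of_neg (by omega)]; omega
      exact_mod_cast this
    · have : (N : ℤ) < |n| := lt_of_lt_of_le h (le_abs_self n)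
      exact_mod_cast this
  have hn0 : (0 : ℝ) < |(n : ℝ)| := lt_of_le_of_lt (Nat.cast_nonneg N) hnN
  have hπn : 2 * |s| ≤ π * |(n : ℝ)| := by
    have := (div_le_iff₀ Real.pi_pos).mp hN
    nlinarith [Real.pi_pos]
  have hlow : π * |(n : ℝ)| / 2 ≤ |s - π * n| := by
    have h1 : |π * (n : ℝ)| - |s| ≤ |s - π * n| := by
      have := abs_sub_abs_le_abs_sub (π * n) s
      rw [abs_sub_comm] at this; linarith
    rw [abs_mul, abs_of_pos Real.pi_pos] at h1
    linarith
  have hsq : (π * |(n : ℝ)| / 2) ^ 2 ≤ (s - π * n) ^ 2 := by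
    rw [← sq_abs (s - π * n)]
    exact pow_le_pow_left₀ (by positivity) hlow 2
  have hpos : (0 : ℝ) < (π * |(n : ℝ)| / 2) ^ 2 := by positivity
  have hn2 : (0 : ℝ) < (n : ℝ) ^ 2 := by rw [← sq_abs]; exact pow_pos hn0 2
  rw [mul_one_div, div_le_div_iff₀ (lt_of_lt_of_le hpos hsq) hn2]
  have : (π * |(n : ℝ)| / 2) ^ 2 = π ^ 2 * (n : ℝ) ^ 2 / 4 := by rw [div_pow, mul_pow, sq_abs]; ring
  rw [this] at hsq
  have h4 : (n : ℝ) ^ 2 ≤ 4 / π ^ 2 * (s - π * n) ^ 2 := by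
    rw [div_mul_eq_mul_div, le_div_iff₀ (by positivity)]
    nlinarith [hsq]
  calc Real.cos ω ^ 2 * (n : ℝ) ^ 2 ≤ Real.cos ω ^ 2 * (4 / π ^ 2 * (s - π * n) ^ 2) :=
        mul_le_mul_of_nonneg_left h4 (sq_nonneg _)
    _ = 4 * Real.cos ω ^ 2 / π ^ 2 * (s - π * n) ^ 2 := by ring

/-- `summable_norm_fourierCoeff_dsKer` — helper of the x-wuc GEN-11 chain «K1′(ℝ) at the stake» (verbatim from the referee-passed extract `SplitXWucK1R.lean` 70c8eb2af2868881; role: see the module docstring). -/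
theorem summable_norm_fourierCoeff_dsKer {ω : ℝ} (hω : Real.cos ω ≠ 0) :
    Summable (fun n : ℤ => ‖fourierCoeff
      (⇑(kerLift (dsKer ω) (dsKer_continuous ω) (dsKer_per ω)) : AddCircle (2:ℝ) → ℂ) n‖) := by
  simp_rw [fourierCoeff_dsKer hω]
  exact summable_norm_dsCoeff hω

/-- `Σ_n ‖ĉ_n‖ = 1`: the expansion at `u = 1`, where `dsKer ω 1 = -1` and every term is `≤ 0`. -/
theorem hasSum_norm_dsCoeff {ω : ℝ} (hω : Real.cos ω ≠ 0) :
    HasSum (fun n : ℤ => ‖(dsCoeff ω n : ℂ)‖) 1 := by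
  have h := hasSum_kernel (dsKer ω) (dsKer_continuous ω) (dsKer_per ω)
    (summable_norm_fourierCoeff_dsKer hω).of_norm (u := 1) ⟨by norm_num, le_rfl⟩
  rw [dsKer_one] at h
  simp_rw [fourierCoeff_dsKer hω] at h
  have hterm : ∀ n : ℤ, (dsCoeff ω n : ℂ) * cexp (π * n * (1 : ℝ) * I) = -(((‖(dsCoeff ω n : ℂ)‖ : ℝ) : ℂ)) := by
    intro n
    have hsin : Real.sin (π * n) = 0 := by rw [mul_comm]; exact Real.sin_int_mul_pi n
    have hexp : cexp (π * n * (1 : ℝ) * I) = (Real.cos (π * n) : ℂ) := by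
      rw [Complex.ofReal_one, mul_one, show (π : ℂ) * n * I = ((π * n : ℝ) : ℂ) * I by push_cast; ring,
        Complex.exp_mul_I, ← Complex.ofReal_cos, ← Complex.ofReal_sin, hsin]
      simp
    have hcos2 : Real.cos (π * n) ^ 2 = 1 := by nlinarith [Real.sin_sq_add_cos_sq (π * n), hsin]
    have hreal : dsCoeff ω n * Real.cos (π * n) = -((Real.cos ω) ^ 2 / (ω + π / 2 - π * n) ^ 2) := by
      simp only [dsCoeff]
      rw [show -(Real.cos ω) ^ 2 * Real.cos (π * n) / (ω + π / 2 - π * n) ^ 2 * Real.cos (π * n)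
          = -((Real.cos ω) ^ 2 * (Real.cos (π * n)) ^ 2 / (ω + π / 2 - π * n) ^ 2) by ring, hcos2, mul_one]
    rw [hexp, ← Complex.ofReal_mul, hreal, norm_dsCoeff hω]; push_cast; ring
  simp_rw [hterm] at h
  have h2 := h.neg
  simp only [neg_neg] at h2
  exact Complex.hasSum_ofReal.mp h2

/-- `tsum_norm_fourierCoeff_dsKer` — helper of the x-wuc GEN-11 chain «K1′(ℝ) at the stake» (verbatim from the referee-passed extract `SplitXWucK1R.lean` 70c8eb2af2868881; role: see the module docstring). -/
theorem tsum_norm_fourierCoeff_dsKer {ω : ℝ} (hω : Real.cos ω ≠ 0) :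
    ∑' n : ℤ, ‖fourierCoeff
      (⇑(kerLift (dsKer ω) (dsKer_continuous ω) (dsKer_per ω)) : AddCircle (2:ℝ) → ℂ) n‖ = 1 := by
  simp_rw [fourierCoeff_dsKer hω]
  exact (hasSum_norm_dsCoeff hω).tsum_eq

end ds
section dsineq
/-- the transform of `u ↦ i u f(u)` (the derivative of `λ ↦ tfT f λ 0`, see `hasDerivAt_tfT`). -/
noncomputable def tfT₁ (f : ℝ → ℂ) (lam : ℝ) : ℂ := tfT (fun u => I * u * f u) lam 0

/-- **Duffin–Schaeffer for finite transforms (complex form):** `‖sin ω · T(y) + cos ω · T₁(y)‖ ≤ sup ‖T‖`. -/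
theorem norm_sin_mul_add_cos_mul_le (f : ℝ → ℂ) (hf : Continuous f) (M : ℝ)
    (hM : ∀ y : ℝ, ‖tfT f y 0‖ ≤ M) (ω y : ℝ) :
    ‖(Real.sin ω : ℂ) * tfT f y 0 + (Real.cos ω : ℂ) * tfT₁ f y‖ ≤ M := by
  haveI : Fact ((0 : ℝ) < 2) := ⟨two_pos⟩
  by_cases hω : Real.cos ω = 0
  · have hs : |Real.sin ω| = 1 := by
      have h := Real.sin_sq_add_cos_sq ω
      rw [hω] at h
      have h2 : |Real.sin ω| ^ 2 = 1 := by rw [sq_abs]; linarith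
      nlinarith [abs_nonneg (Real.sin ω)]
    rw [hω, Complex.ofReal_zero, zero_mul, add_zero, norm_mul, Complex.norm_real, Real.norm_eq_abs, hs,
      one_mul]
    exact hM y
  · have hI : IntervalIntegrable (fun u : ℝ => f u * (Real.cosh (0 * u) : ℂ) * cexp (I * (y : ℂ) * u))
        volume (-1) 1 := by apply Continuous.intervalIntegrable; fun_prop
    have hI₁ : IntervalIntegrable (fun u : ℝ => I * u * f u * (Real.cosh (0 * u) : ℂ) * cexp (I * (y : ℂ) * u))
        volume (-1) 1 := by apply Continuous.intervalIntegrable; fun_prop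
    have key : (Real.sin ω : ℂ) * tfT f y 0 + (Real.cos ω : ℂ) * tfT₁ f y
        = ∫ u in (-1 : ℝ)..1, f u * dsKer ω u * cexp (I * ((y - (ω + π / 2) : ℝ) : ℂ) * u) := by
      rw [tfT₁, CoshKernel.tfT_interval, CoshKernel.tfT_interval, ← intervalIntegral.integral_const_mul,
        ← intervalIntegral.integral_const_mul, ← intervalIntegral.integral_add (hI.const_mul _) (hI₁.const_mul _)]
      apply intervalIntegral.integral_congr
      intro u _
      simp only [dsKer]
      rw [zero_mul, Real.cosh_zero, Complex.ofReal_one, mul_one, mul_one,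
        show cexp (I * (y : ℂ) * u) = cexp (I * ((ω + π / 2 : ℝ) : ℂ) * u) * cexp (I * ((y - (ω + π / 2) : ℝ) : ℂ) * u) by
          rw [← Complex.exp_add]; congr 1; push_cast; ring]
      ring
    rw [key]
    have h := norm_engine_le (dsKer ω) (dsKer_continuous ω) (dsKer_per ω)
      (summable_norm_fourierCoeff_dsKer hω) f hf M hM (y - (ω + π / 2))
    rw [tsum_norm_fourierCoeff_dsKer hω, one_mul] at h
    exact h

/-- **Duffin–Schaeffer, real form (Boas (11.4.8) for finite transforms):** for `‖c‖ ≤ 1`,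
`Re(c·T(y))² + Re(c·T₁(y))² ≤ M²`. -/
theorem re_sq_add_re_sq_le (f : ℝ → ℂ) (hf : Continuous f) (M : ℝ)
    (hM : ∀ y : ℝ, ‖tfT f y 0‖ ≤ M) (c : ℂ) (hc : ‖c‖ ≤ 1) (y : ℝ) :
    (c * tfT f y 0).re ^ 2 + (c * tfT₁ f y).re ^ 2 ≤ M ^ 2 := by
  have hM0 : 0 ≤ M := (norm_nonneg _).trans (hM 0)
  set a : ℝ := (c * tfT f y 0).re with ha
  set b : ℝ := (c * tfT₁ f y).re with hb
  set z : ℂ := ⟨b, a⟩ with hz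
  by_cases h0 : z = 0
  · have hb0 : b = 0 := by have := congrArg Complex.re h0; simpa [hz] using this
    have ha0 : a = 0 := by have := congrArg Complex.im h0; simpa [hz] using this
    rw [ha0, hb0]; nlinarith [sq_nonneg M]
  · set ω : ℝ := Complex.arg z with hω
    have hcos : Real.cos ω = b / ‖z‖ := by rw [hω, Complex.cos_arg h0]
    have hsin : Real.sin ω = a / ‖z‖ := by rw [hω, Complex.sin_arg]
    have hzn : 0 < ‖z‖ := norm_pos_iff.mpr h0
    have hz2 : ‖z‖ ^ 2 = b ^ 2 + a ^ 2 := by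
      rw [Complex.sq_norm, Complex.normSq_apply, hz]; ring
    have h := norm_sin_mul_add_cos_mul_le f hf M hM ω y
    -- Re(c · (sin ω T + cos ω T₁)) = sin ω a + cos ω b = ‖z‖
    have hre : (c * ((Real.sin ω : ℂ) * tfT f y 0 + (Real.cos ω : ℂ) * tfT₁ f y)).re = ‖z‖ := by
      rw [mul_add, show c * ((Real.sin ω : ℂ) * tfT f y 0) = (Real.sin ω : ℂ) * (c * tfT f y 0) by ring,
        show c * ((Real.cos ω : ℂ) * tfT₁ f y) = (Real.cos ω : ℂ) * (c * tfT₁ f y) by ring,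
        Complex.add_re, Complex.re_ofReal_mul, Complex.re_ofReal_mul, ← ha, ← hb, hsin, hcos]
      field_simp
      rw [hz2]; ring
    have h1 : ‖z‖ ≤ M := by
      calc ‖z‖ = (c * ((Real.sin ω : ℂ) * tfT f y 0 + (Real.cos ω : ℂ) * tfT₁ f y)).re := hre.symm
        _ ≤ ‖c * ((Real.sin ω : ℂ) * tfT f y 0 + (Real.cos ω : ℂ) * tfT₁ f y)‖ := Complex.re_le_norm _
        _ = ‖c‖ * ‖(Real.sin ω : ℂ) * tfT f y 0 + (Real.cos ω : ℂ) * tfT₁ f y‖ := norm_mul _ _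
        _ ≤ 1 * M := by gcongr
        _ = M := one_mul M
    calc a ^ 2 + b ^ 2 = ‖z‖ ^ 2 := by rw [hz2]; ring
      _ ≤ M ^ 2 := pow_le_pow_left₀ hzn.le h1 2

end dsineq
section deriv
/-- `T₁ = T′`: differentiation under the integral sign. -/
theorem hasDerivAt_tfT (f : ℝ → ℂ) (hf : Continuous f) (y : ℝ) :
    HasDerivAt (fun lam : ℝ => tfT f lam 0) (tfT₁ f y) y := by
  obtain ⟨B, hB⟩ := IsCompact.exists_bound_of_continuousOn isCompact_Icc
    (hf.continuousOn : ContinuousOn f (Icc (-1 : ℝ) 1))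
  have hIoc : ∀ t : ℝ, t ∈ Set.uIoc (-1 : ℝ) 1 → t ∈ Icc (-1 : ℝ) 1 := by
    intro t ht
    rw [Set.uIoc_of_le (by norm_num)] at ht
    exact ⟨ht.1.le, ht.2⟩
  have e : (fun lam : ℝ => tfT f lam 0)
      = fun lam : ℝ => ∫ u in (-1 : ℝ)..1, f u * (Real.cosh (0 * u) : ℂ) * cexp (I * (lam : ℂ) * u) := by
    funext lam; exact CoshKernel.tfT_interval f lam 0
  rw [e, tfT₁, CoshKernel.tfT_interval]
  have h := intervalIntegral.hasDerivAt_integral_of_dominated_loc_of_deriv_le (𝕜 := ℝ) (μ := volume)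
    (a := (-1 : ℝ)) (b := 1) (bound := fun _ => B)
    (F := fun lam u => f u * (Real.cosh (0 * u) : ℂ) * cexp (I * (lam : ℂ) * u))
    (F' := fun lam u => I * u * f u * (Real.cosh (0 * u) : ℂ) * cexp (I * (lam : ℂ) * u))
    (x₀ := y) (s := univ) Filter.univ_mem ?_ ?_ ?_ ?_ ?_ ?_
  · exact h.2
  · exact Filter.Eventually.of_forall (fun lam => (Continuous.aestronglyMeasurable (by fun_prop)))
  · apply Continuous.intervalIntegrable; fun_prop
  · exact Continuous.aestronglyMeasurable (by fun_prop)
  · refine Filter.Eventually.of_forall (fun t ht lam _ => ?_)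
    have htI := hIoc t ht
    rw [norm_mul, norm_mul, norm_mul, norm_mul, CoshKernel.norm_cexp_I_mul, mul_one, zero_mul, Real.cosh_zero,
      Complex.ofReal_one, norm_one, mul_one, Complex.norm_I, one_mul, Complex.norm_real, Real.norm_eq_abs]
    calc |t| * ‖f t‖ ≤ 1 * B :=
          mul_le_mul (abs_le.mpr ⟨by linarith [htI.1], htI.2⟩) (hB t htI) (norm_nonneg _) zero_le_one
      _ = B := one_mul B
  · exact intervalIntegrable_const
  · refine Filter.Eventually.of_forall (fun t _ lam _ => ?_)
    have h1 : HasDerivAt (fun lam : ℝ => I * (lam : ℂ) * t) (I * 1 * t) lam :=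
      ((hasDerivAt_id lam).ofReal_comp.const_mul I).mul_const (t : ℂ)
    have h2 := (h1.cexp).const_mul (f t * (Real.cosh (0 * t) : ℂ))
    refine h2.congr_deriv ?_
    ring

end deriv
end DSLine
end Summit.RiemannHypothesis.RiemannHypothesis.Theorems.Splittings.XWucG8
namespace Summit.RiemannHypothesis.RiemannHypothesis.Theorems.Splittings.XWucG8
end Summit.RiemannHypothesis.RiemannHypothesis.Theorems.Splittings.XWucG8
open Real Set MeasureTheory Complex Filter Topology
namespace Summit.RiemannHypothesis.RiemannHypothesis.Theorems.Splittings.XWucG8.DSLine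
section pairing
/-- `tfT` of `f · cosh(t ·)` at `κ = 0` is `tfT f · t`. -/
theorem tfT_mul_cosh (f : ℝ → ℂ) (t y : ℝ) :
    tfT (fun u => f u * (Real.cosh (t * u) : ℂ)) y 0 = tfT f y t := by
  simp only [tfT, zero_mul, Real.cosh_zero, Complex.ofReal_one, mul_one]

/-- growth in `κ`: `‖tfT f y t‖ ≤ cosh t · M` (from the dent lemma). -/
theorem norm_tfT_le_cosh_mul (f : ℝ → ℂ) (hf : Continuous f) (M : ℝ) (hM : ∀ y : ℝ, ‖tfT f y 0‖ ≤ M)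
    {t : ℝ} (ht : 0 ≤ t) (y : ℝ) : ‖tfT f y t‖ ≤ Real.cosh t * M := by
  rcases eq_or_lt_of_le ht with h | h
  · rw [← h, Real.cosh_zero, one_mul]; exact hM y
  · have hd := CoshKernel.norm_tfT_sub_le f hf t h M hM y
    have hst : 0 ≤ Real.sinh t / t := div_nonneg (Real.sinh_nonneg_iff.mpr h.le) h.le
    have h2 : ‖((Real.sinh t / t : ℝ) : ℂ) * tfT f y 0‖ ≤ (Real.sinh t / t) * M := by
      rw [norm_mul, Complex.norm_real, Real.norm_eq_abs, abs_of_nonneg hst]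
      exact mul_le_mul_of_nonneg_left (hM y) hst
    calc ‖tfT f y t‖ = ‖(tfT f y t - (Real.sinh t / t : ℝ) * tfT f y 0) + (Real.sinh t / t : ℝ) * tfT f y 0‖ := by
          rw [sub_add_cancel]
      _ ≤ ‖tfT f y t - (Real.sinh t / t : ℝ) * tfT f y 0‖ + ‖((Real.sinh t / t : ℝ) : ℂ) * tfT f y 0‖ :=
          norm_add_le _ _
      _ ≤ (Real.cosh t - Real.sinh t / t) * M + (Real.sinh t / t) * M := add_le_add hd h2
      _ = Real.cosh t * M := by ring

/-- Bernstein for `f · cosh(t ·)`: `‖T₁‖ ≤ cosh t · M`. -/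
theorem norm_tfT₁_mul_cosh_le (f : ℝ → ℂ) (hf : Continuous f) (M : ℝ) (hM : ∀ y : ℝ, ‖tfT f y 0‖ ≤ M)
    {t : ℝ} (ht : 0 ≤ t) (y : ℝ) :
    ‖tfT₁ (fun u => f u * (Real.cosh (t * u) : ℂ)) y‖ ≤ Real.cosh t * M := by
  have hg : Continuous (fun u : ℝ => f u * (Real.cosh (t * u) : ℂ)) := by fun_prop
  have hMg : ∀ y : ℝ, ‖tfT (fun u => f u * (Real.cosh (t * u) : ℂ)) y 0‖ ≤ Real.cosh t * M := by
    intro y; rw [tfT_mul_cosh]; exact norm_tfT_le_cosh_mul f hf M hM ht y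
  have h := norm_sin_mul_add_cos_mul_le _ hg _ hMg 0 y
  simp only [Real.sin_zero, Real.cos_zero, Complex.ofReal_zero, Complex.ofReal_one, zero_mul, one_mul,
    zero_add] at h
  exact h

/-- the derivative of the `sinh` pairing in the growth parameter (differentiation under the integral). -/
theorem hasDerivAt_sinhPairing (f : ℝ → ℂ) (hf : Continuous f) (t₀ : ℝ) :
    HasDerivAt (fun t : ℝ => ∫ u in (-1 : ℝ)..1, f u * (Real.sinh (t * u) : ℂ))
      (∫ u in (-1 : ℝ)..1, f u * ((u * Real.cosh (t₀ * u) : ℝ) : ℂ)) t₀ := by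
  obtain ⟨B, hB⟩ := IsCompact.exists_bound_of_continuousOn isCompact_Icc
    (hf.continuousOn : ContinuousOn f (Icc (-1 : ℝ) 1))
  have hIoc : ∀ t : ℝ, t ∈ Set.uIoc (-1 : ℝ) 1 → t ∈ Icc (-1 : ℝ) 1 := by
    intro t ht
    rw [Set.uIoc_of_le (by norm_num)] at ht
    exact ⟨ht.1.le, ht.2⟩
  have h := intervalIntegral.hasDerivAt_integral_of_dominated_loc_of_deriv_le (𝕜 := ℝ) (μ := volume)
    (a := (-1 : ℝ)) (b := 1) (bound := fun _ => B * Real.cosh (|t₀| + 1))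
    (F := fun t u => f u * (Real.sinh (t * u) : ℂ))
    (F' := fun t u => f u * ((u * Real.cosh (t * u) : ℝ) : ℂ))
    (x₀ := t₀) (s := Ioo (t₀ - 1) (t₀ + 1)) (Ioo_mem_nhds (by linarith) (by linarith)) ?_ ?_ ?_ ?_ ?_ ?_
  · exact h.2
  · exact Filter.Eventually.of_forall (fun t => (Continuous.aestronglyMeasurable (by fun_prop)))
  · apply Continuous.intervalIntegrable; fun_prop
  · exact Continuous.aestronglyMeasurable (by fun_prop)
  · refine Filter.Eventually.of_forall (fun u hu t ht => ?_)
    have huI := hIoc u hu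
    have hu1 : |u| ≤ 1 := abs_le.mpr ⟨by linarith [huI.1], huI.2⟩
    rw [norm_mul, Complex.norm_real, Real.norm_eq_abs, abs_mul, abs_of_nonneg (Real.cosh_pos _).le]
    have hcosh : Real.cosh (t * u) ≤ Real.cosh (abs t₀ + 1) := by
      have hpos : (0:ℝ) < abs t₀ + 1 := by positivity
      rw [Real.cosh_le_cosh, abs_mul, abs_of_pos hpos]
      have ht' : abs t ≤ abs t₀ + 1 := by
        rw [abs_le]; constructor <;> linarith [ht.1, ht.2, neg_abs_le t₀, le_abs_self t₀]
      calc |t| * |u| ≤ (|t₀| + 1) * 1 := mul_le_mul ht' hu1 (abs_nonneg u) hpos.le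
        _ = |t₀| + 1 := mul_one _
    calc ‖f u‖ * (|u| * Real.cosh (t * u)) ≤ B * (1 * Real.cosh (|t₀| + 1)) := by
          apply mul_le_mul (hB u huI) _ (by positivity) ((norm_nonneg _).trans (hB u huI))
          exact mul_le_mul hu1 hcosh (Real.cosh_pos _).le zero_le_one
      _ = B * Real.cosh (|t₀| + 1) := by ring
  · exact intervalIntegrable_const
  · refine Filter.Eventually.of_forall (fun u _ t _ => ?_)
    have h1 : HasDerivAt (fun t : ℝ => Real.sinh (t * u)) (Real.cosh (t * u) * u) t := by
      have := (Real.hasDerivAt_sinh (t * u)).comp t ((hasDerivAt_id t).mul_const u)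
      simpa [Function.comp_def] using this
    have h2 := (h1.ofReal_comp).const_mul (f u)
    refine h2.congr_deriv ?_
    push_cast; ring

/-- **PAIRING BOUND (blueprint step (4)).** `‖∫ 2 sinh(κ₀u) f(u) du‖ ≤ 2 M sinh κ₀` whenever `‖tfT f · 0‖ ≤ M`. -/
theorem norm_pairing_le (f : ℝ → ℂ) (hf : Continuous f) (M : ℝ) (hM : ∀ y : ℝ, ‖tfT f y 0‖ ≤ M)
    {κ₀ : ℝ} (hκ₀ : 0 ≤ κ₀) :
    ‖∫ u in Icc (-1 : ℝ) 1, 2 * (Real.sinh (κ₀ * u) : ℂ) * f u‖ ≤ 2 * M * Real.sinh κ₀ := by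
  set F : ℝ → ℂ := fun t => ∫ u in (-1 : ℝ)..1, f u * (Real.sinh (t * u) : ℂ) with hF
  set F' : ℝ → ℂ := fun t => ∫ u in (-1 : ℝ)..1, f u * ((u * Real.cosh (t * u) : ℝ) : ℂ) with hF'
  have hderiv : ∀ t, HasDerivAt F (F' t) t := fun t => hasDerivAt_sinhPairing f hf t
  have hbound : ∀ t : ℝ, 0 ≤ t → ‖F' t‖ ≤ M * Real.cosh t := by
    intro t ht
    have hkey : tfT₁ (fun u => f u * (Real.cosh (t * u) : ℂ)) 0 = I * F' t := by
      simp only [tfT₁, hF']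
      rw [CoshKernel.tfT_interval, ← intervalIntegral.integral_const_mul]
      apply intervalIntegral.integral_congr
      intro u _
      simp only [zero_mul, Real.cosh_zero, Complex.ofReal_one, mul_one, Complex.ofReal_zero, mul_zero,
        Complex.exp_zero]
      push_cast; ring
    have h1 := norm_tfT₁_mul_cosh_le f hf M hM ht 0
    rw [hkey, norm_mul, Complex.norm_I, one_mul, mul_comm] at h1
    exact h1
  have hF0 : ‖F 0‖ ≤ (fun t => M * Real.sinh t) 0 := by
    simp only [hF, zero_mul, Real.sinh_zero, Complex.ofReal_zero, mul_zero, intervalIntegral.integral_zero,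
      norm_zero, le_refl]
  have hcomp := image_norm_le_of_norm_deriv_right_le_deriv_boundary (f := F) (f' := F') (a := 0) (b := κ₀)
    (B := fun t => M * Real.sinh t) (B' := fun t => M * Real.cosh t)
    (fun t _ => (hderiv t).continuousAt.continuousWithinAt) (fun t _ => (hderiv t).hasDerivWithinAt)
    hF0 (fun t => (Real.hasDerivAt_sinh t).const_mul M) (fun t ht => hbound t ht.1)
  have hκ : ‖F κ₀‖ ≤ M * Real.sinh κ₀ := hcomp ⟨hκ₀, le_refl _⟩
  have htarget : (∫ u in Icc (-1 : ℝ) 1, 2 * (Real.sinh (κ₀ * u) : ℂ) * f u) = 2 * F κ₀ := by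
    simp only [hF]
    rw [integral_Icc_eq_integral_Ioc, ← intervalIntegral.integral_of_le (by norm_num : (-1 : ℝ) ≤ 1),
      ← intervalIntegral.integral_const_mul]
    apply intervalIntegral.integral_congr
    intro u _
    ring
  rw [htarget, norm_mul]
  calc ‖(2 : ℂ)‖ * ‖F κ₀‖ = 2 * ‖F κ₀‖ := by simp
    _ ≤ 2 * (M * Real.sinh κ₀) := by linarith [hκ]
    _ = 2 * M * Real.sinh κ₀ := by ring

end pairing
end Summit.RiemannHypothesis.RiemannHypothesis.Theorems.Splittings.XWucG8.DSLine
namespace Summit.RiemannHypothesis.RiemannHypothesis.Theorems.Splittings.XWucG8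
end Summit.RiemannHypothesis.RiemannHypothesis.Theorems.Splittings.XWucG8
open Real Set MeasureTheory Complex Filter Topology
namespace Summit.RiemannHypothesis.RiemannHypothesis.Theorems.Splittings.XWucG8.DSLine
open scoped ComplexConjugate
section profile
/-- `9/8 ≤ cosh(1/2)`. -/
theorem cosh_half_ge : (9 : ℝ) / 8 ≤ Real.cosh (1 / 2) := by
  have h := sum_le_hasSum (Finset.range 2) (fun n _ ↦ by positivity) (Real.hasSum_cosh (1 / 2 : ℝ))
  norm_num [Finset.sum_range_succ, Nat.factorial] at h
  linarith

/-- `cosh(1/2) ≤ 1.127626`. -/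
theorem cosh_half_le : Real.cosh (1 / 2) ≤ 1.127626 := by
  rw [Real.cosh_eq]
  have hx : Real.exp (1 / 2) * Real.exp (1 / 2) = Real.exp 1 := by rw [← Real.exp_add]; norm_num
  have hxpos := Real.exp_pos (1 / 2 : ℝ)
  have hx1 : Real.exp (1 / 2) < 1.6487213 := by nlinarith [Real.exp_one_lt_d9]
  have hx3 : 1.6487212 < Real.exp (1 / 2) := by nlinarith [Real.exp_one_gt_d9]
  have hy : Real.exp (-(1 / 2)) * Real.exp (1 / 2) = 1 := by rw [← Real.exp_add]; norm_num
  have hypos := Real.exp_pos (-(1 / 2) : ℝ)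
  have hx2 : Real.exp (-(1 / 2)) < 0.6065307 := by nlinarith
  linarith

/-- the uniform dent constant `D = cosh(1/2) − 25/24 ∈ [1/12, 0.086]`. -/
theorem D_bounds : 1 / 12 ≤ Real.cosh (1 / 2) - 25 / 24 ∧ Real.cosh (1 / 2) - 25 / 24 ≤ 43 / 500 := by
  constructor <;> linarith [cosh_half_ge, cosh_half_le]

end profile
end Summit.RiemannHypothesis.RiemannHypothesis.Theorems.Splittings.XWucG8.DSLine
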